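import Summits.KontsevichZagierPeriods.KontsevichZagierPeriods.Theorems.PentagonInKZ.Negative.WeightThreeTightness

/-!
# `PentagonInKZ` — negative lane, §16e: `D[U]` is faithful; the level-3 pentagon IS weight-3 duality

Standing adversary (cdisprove seat, generation 3) on the crux `PentagonInKZ`
(stmt-KontsevichZagierPeriods-11348).

The pentagon defect element `D[U] ∈ U𝔞₄ ⊗ S/(deg > 3)` (`pentD S 3 KU`,
`Negative/WeightThreeTightness.lean`) is FAITHFUL: `r · D[U] = 0 → r = 0` for every `r ∈ S`
(`pentD_KU_faithful`) — its image in the shifted permutation representation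
`t_ij ↦ (P_{(ij)} - 1) ⊗ J` of `AssociatorsPentagonWeightThree.lean` has entry `1` at
`((0,0),(3,3))`.  Consequently, in EVERY realisation `χ` of the rules,
**`PentAt Φ_χ 3 ↔ χ⟦ζ(3)⟧ = χ⟦ζ(2,1)⟧`** (`cruxSeries_pentAt_three_iff_duality`) and the crux
modulo weight 4 is EXACTLY weight-3 duality in every realisation
(`pentAt_le_three_iff_duality`); at the universal realisation this reads: `Φ_P` satisfies the
pentagon modulo weight 4 iff `⟦ζ(3)⟧ = ⟦ζ(2,1)⟧` in `P_ℚ`.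
-/

noncomputable section

open Literature.NumberTheory.Transcendental
open Matrix
open scoped Kronecker

namespace Summit.KontsevichZagierPeriods.FurushoPentagon.PentagonInKZNegative

open Summit.KontsevichZagierPeriods.KontsevichZagierPeriods.Theses.FurushoPentagon (PentagonInKZ)

/-! ## §16e Faithfulness of `D[U]` -/

section Faithful

open NCSeries.PermRep

variable {S : Type} [CommRing S]

/-- **`D[U]` is faithful**: `r · D[U] = 0` in `U𝔞₄ ⊗ S/(deg > 3)` forces `r = 0` (apply the
shifted permutation representation and read the entry `((0,0),(3,3))`, which is `r · 1`).
[cite: BarNatan1998, §3] -/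
theorem pentD_KU_faithful (r : S) (h : r • pentD S 3 KU = 0) : r = 0 := by
  obtain ⟨W, hW⟩ := exists_algHom (S := S)
  have hp := congrArg W h
  rw [map_smul, map_zero] at hp
  simp only [pentD, KU, map_sub, map_add, map_mul, hW, v] at hp
  simp only [← Matrix.add_kronecker, ← map_add (Fm S)] at hp
  simp only [← Matrix.mul_kronecker_mul, ← map_mul (Fm S)] at hp
  have he := congrArg (fun M : Matrix (Fin 4 × Fin 4) (Fin 4 × Fin 4) S =>
    M ((0 : Fin 4), (0 : Fin 4)) ((3 : Fin 4), (3 : Fin 4))) hp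
  simp only [Matrix.smul_apply, Matrix.sub_apply, Matrix.add_apply, Matrix.kroneckerMap_apply,
    Matrix.zero_apply, smul_eq_mul] at he
  -- the fifteen decided integer entries `(word(A_k,B_k))₀₃`
  have ent1_fft : (Qz (0, 1) * Qz (0, 1) * (Qz (1, 2) + Qz (1, 3))) 0 3 = -2 := by decide
  have ent1_ftf : (Qz (0, 1) * (Qz (1, 2) + Qz (1, 3)) * Qz (0, 1)) 0 3 = 0 := by decide
  have ent1_tff : ((Qz (1, 2) + Qz (1, 3)) * Qz (0, 1) * Qz (0, 1)) 0 3 = 0 := by decide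
  have ent2_fft : ((Qz (0, 2) + Qz (1, 2)) * (Qz (0, 2) + Qz (1, 2)) * Qz (2, 3)) 0 3 = -3 := by decide
  have ent2_ftf : ((Qz (0, 2) + Qz (1, 2)) * Qz (2, 3) * (Qz (0, 2) + Qz (1, 2))) 0 3 = 0 := by decide
  have ent2_tff : (Qz (2, 3) * (Qz (0, 2) + Qz (1, 2)) * (Qz (0, 2) + Qz (1, 2))) 0 3 = 0 := by decide
  have ent3_fft : (Qz (1, 2) * Qz (1, 2) * Qz (2, 3)) 0 3 = 0 := by decide
  have ent3_ftf : (Qz (1, 2) * Qz (2, 3) * Qz (1, 2)) 0 3 = 0 := by decide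
  have ent3_tff : (Qz (2, 3) * Qz (1, 2) * Qz (1, 2)) 0 3 = 0 := by decide
  have ent4_fft : ((Qz (0, 1) + Qz (0, 2)) * (Qz (0, 1) + Qz (0, 2)) * (Qz (1, 3) + Qz (2, 3))) 0 3 = -6 := by decide
  have ent4_ftf : ((Qz (0, 1) + Qz (0, 2)) * (Qz (1, 3) + Qz (2, 3)) * (Qz (0, 1) + Qz (0, 2))) 0 3 = 0 := by decide
  have ent4_tff : ((Qz (1, 3) + Qz (2, 3)) * (Qz (0, 1) + Qz (0, 2)) * (Qz (0, 1) + Qz (0, 2))) 0 3 = 0 := by decide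
  have ent5_fft : (Qz (0, 1) * Qz (0, 1) * Qz (1, 2)) 0 3 = 0 := by decide
  have ent5_ftf : (Qz (0, 1) * Qz (1, 2) * Qz (0, 1)) 0 3 = 0 := by decide
  have ent5_tff : (Qz (1, 2) * Qz (0, 1) * Qz (0, 1)) 0 3 = 0 := by decide
  simp only [RingHom.mapMatrix_apply, Matrix.map_apply, Jz_facts.2.2, ent1_fft, ent1_ftf, ent1_tff,
    ent2_fft, ent2_ftf, ent2_tff, ent3_fft, ent3_ftf, ent3_tff, ent4_fft, ent4_ftf, ent4_tff,
    ent5_fft, ent5_ftf, ent5_tff, map_zero, map_one, map_neg, map_ofNat, mul_one,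
    add_zero, sub_zero] at he
  linear_combination he

end Faithful

/-! ## §16f The crux modulo weight 4 is EXACTLY weight-3 duality, realisation by realisation -/

section Exact

variable {R : Type} [CommRing R] [Algebra ℚ R] {χ : KZ.FormalRep →+ R} {Z : List ℕ → KZ.FormalRep}

/-- **`PentAt Φ_χ 3 ↔ χ⟦ζ(3)⟧ = χ⟦ζ(2,1)⟧` in every realisation.** [cite: Furusho2011, §2] -/
theorem cruxSeries_pentAt_three_iff_duality (hχ : IsRealisation R χ) (hZ : AgreesWithSimplex Z) :
    NCSeries.PentAt (cruxSeries R χ Z) 3 ↔ χ (Z [3]) = χ (Z [2, 1]) := by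
  rw [cruxSeries_pentAt_three_iff hχ hZ]
  refine ⟨fun h => ?_, fun h => by rw [h, sub_self, zero_smul]⟩
  have := pentD_KU_faithful _ h
  exact (sub_eq_zero.mp this).symm

/-- **The pentagon for `Φ_χ` in all levels `≤ 3` ↔ weight-3 duality in `χ`.** Together with
`weight_three_content` / `pentagonInKZ_of_summit`: this is the exact second rung of the crux.
[cite: Furusho2011, §2] -/
theorem pentAt_le_three_iff_duality (hχ : IsRealisation R χ) (hZ : AgreesWithSimplex Z) :
    (∀ N ≤ 3, NCSeries.PentAt (cruxSeries R χ Z) N) ↔ χ (Z [3]) = χ (Z [2, 1]) :=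
  ⟨fun h => (cruxSeries_pentAt_three_iff_duality hχ hZ).mp (h 3 le_rfl),
    pentAt_le_three_of_duality hχ hZ⟩

end Exact

end Summit.KontsevichZagierPeriods.FurushoPentagon.PentagonInKZNegative
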